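import Literature.MathematicalPhysics.QuantumFieldTheory.Balaban1983to89.B8Eq198CubeMemberOfReal12
import Literature.MathematicalPhysics.QuantumFieldTheory.Balaban1983to89.B8Eq192DentedCubeMemberOfReal1G

/-!
# `Balaban1983to89.B8Eq198DentedCubeMemberOfReal12` — [Balaban1985RegularSpaces] (1.98) FROM (1.101) AND (1.92) ON THE DENTED CUBE MEMBER `{Ω′_j}` OF
# [Balaban1985Variational] (148)–(150): the REAL-3 family of the flat p6 consumer at a dented member is ALGEBRA over REAL-1 and REAL-2 there

statement-level skeleton of published theorems with citation tags; proofs where landed; nothing here is a claim about the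
Yang–Mills mass gap

`[Balaban1985RegularSpaces]` ("B8" = [6], CMP **99** (1985) 75–102) (1.98) p. 92 («Let us recall that from Theorems 3.1, 3.2 of [4] it follows that |Rf| ≦ B′₀|f|»), (1.92) p. 91,
(1.101) p. 93, (1.131) p. 99; `[Balaban1985BackgroundPropagators]` ("[4]") Theorems 3.1–3.2 pp. 397–398, (3.25) p. 394; `[Balaban1985Variational]` ("[15]") (148)–(150) p. 301.
PDF held: `paper:balaban1985-cmp99-regular-spaces-gauge-fixing`.

CITATION HEADER (lean-in-tree rule).  Cell `pub-ymgap` (HUMAN RULING D-0062, Track A), DAG node N05 = [B8], seat `pub-ymgap-dag-n05-e` (g31; FAN-OUT §N05 row s3b, Proposition-6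
lane, the (β) road over NODE 00's dented datum `Node00.CubeB8D`, p655171).  WHY THIS FILE.  Sibling of `B8Eq192DentedCubeMemberOfReal1G` ((d3)-14): the dented twin of
dag-n05-c's `B8Eq198CubeMemberOfReal12.real3_of_real1_real2` — ★ `real3_of_real1_real2_dented`, statement and proof VERBATIM under the letter map `cubeFam false … j ↦ c.sq j`,
`cubeLamS … n ↦ c.lamST n`, `(a, M, ρ, k) ↦ c`'s fields, the five geometric facts swapped for (d3)-14 §1's (`cover_dented`, `towerBlock_subset_sq`, `not_mem_sq_of_tower_lt`,
`le_towerLevel_dented`) and p663356's `tower_meets_dented` ∕ `towers_disjoint_dented`; the generic row ∕ block lemmas (`K_row_sum_zeroExt`, `card_filter_block_le`,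
`stencil_sum_zeroExt`, `block_eq_image`) reused by name.  Together the two files REDUCE the crown's named REAL input `Real123DentedCubeMemberPrinted` ((d3)-12) to the dented
REAL-1 ∕ REAL-1′ facts and the dented 𝒢-bound `GBoundDentedCubeMemberPrinted` (p661669) — next file.  Kind «kernel-checked proof», theorems only, no `def`.

HONEST SCOPE ∕ NOT CLAIMED.  Pure algebra + lattice bookkeeping; REAL-1 ∕ REAL-2 are HYPOTHESES displayed per datum; nothing of [4]∕[6]∕[15] asserted; count-neutral; N05 ∕ N07
NOT discharged; one finite `𝕋⁴` programme at fixed `ε`, Bałaban as printed; nothing continuum ∕ ℝ⁴ ∕ OS ∕ mass-gap ∕ Clay.  No `sorry`, no `def`, no `instance`, no `notation`.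
Unit `pub-ymgap-dag-n05-e` (g31), 2026-08-28.

RELATED IN THE TREE, NOT DUPLICATED (`rg` 2026-08-28T20:57Z: `ls Balaban1983to89 | grep -ci 'Eq198Dented'` = 0): `B8Eq198CubeMemberOfReal12` (dag-n05-c; the PURE model; its
§1–§2 generic lemmas USED), `B8Eq192DentedCubeMemberOfReal1G` ((d3)-14; §1 USED), `B8Eq191FlatLettersDentedCubeMember` (p663356; USED).
-/

noncomputable section

namespace Literature.MathematicalPhysics.QuantumFieldTheory.Balaban1983to89.B8Eq198DentedCubeMemberOfReal12

open scoped Matrix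
open B7Prop1Explicit (e)
open B8LambdaSpaceKLevel (wt)
open B8Eq191FlatDirichletForm (isUnit_flatMatrix)
open B8Eq191FlatTowerGram (isUnit_towerGram)
open B8Eq191FlatDirichletCoercive (block_eq_image)
open B8Eq198CubeMemberOfReal12 (stencil_sum_zeroExt K_row_sum_zeroExt card_filter_block_le)
open B8Eq191FlatLettersDentedCubeMember (tower_meets_dented towers_disjoint_dented)
open B8Eq192DentedCubeMemberOfReal1G (cover_dented towerBlock_subset_sq not_mem_sq_of_tower_lt le_towerLevel_dented)
open Node00 (CubeB8D)
open Literature.MathematicalPhysics.QuantumLattice (blockMap)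

variable {d : ℕ}

/-! ## §1 REAL-3 at the dented member from REAL-1 and REAL-2 there -/

open Classical in
/-- **(1.98) FROM (1.101) AND (1.92) ON THE DENTED CUBE MEMBER `{Ω′_j}` OF [Balaban1985Variational] (148)–(150) — THE CONSUMER'S REAL-3 FAMILY IS ALGEBRA OVER REAL-1 AND REAL-2** (the dented twin of `B8Eq198CubeMemberOfReal12.real3_of_real1_real2`: the same algebra over the dented site tower `c.sq` and cells `c.lamST n`; geometry through `B8Eq192DentedCubeMemberOfReal1G` §1) (B8 p. 92 «Let us recall that from
Theorems 3.1, 3.2 of [4] it follows that |Rf| ≦ B′₀|f|»).  Data: the explicit matrices `T = (K(x,z))`, `Q` of `B8Prop6CubeMemberFlatScalar.prop6_cubeMember_flat_of_real` at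
truncation `n` (any `L ≥ 1`, any nonnegative weights with normalised size `w_jη²L^{2j}L^{−(d+1)j} ≤ a_max`).  Hypotheses: the FUNCTION member of REAL-1 (constant `B_G`)
and the FUNCTION + Δ members of REAL-2 (constants `B₀′_H`, `B₂′`), in the consumer's verbatim shapes.  Conclusion: REAL-3 verbatim with `B_R = 1 + (B₂′ + a_max)B_G`:
`wt(j)²|ρ′(v) − (T⁻¹Qᵀ(QT⁻²Qᵀ)⁻¹QT⁻¹ρ′)(v)| ≤ B_R r` on `□_j`.  MECHANISM: `T⁻¹Qᵀ(QT⁻²Qᵀ)⁻¹QT⁻¹ρ′ = T·λ` with `λ = H′X`, `H′ = T⁻¹(T⁻¹Qᵀ)(QT⁻²Qᵀ)⁻¹`, `X = Q·T⁻¹ρ′`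
(`TT⁻¹ = 1`); `|X| ≤ B_G r` (block averages of `T⁻¹ρ′`, REAL-1); the row formula gives `(Tλ)(v) = η⁻²(−Δλ)(v) + w_J L^{−2(d+1)J}·L^{(d+1)J}(Qλ)_{p(v)}` at the tower
level `J ≥ j` of `v`, with `Qλ = QH′X = X` (`QH′ = 1`, n05-e's `isUnit_towerGram`) and the Δ-entry of REAL-2.
[cite: Balaban1985RegularSpaces, (1.98) p.92, (1.92) p.91, (1.101) p.93, (1.131) p.99; Balaban1985BackgroundPropagators, Theorems 3.1–3.2 pp.397–398, (3.25) p.394] -/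
theorem real3_of_real1_real2_dented {L : ℕ} (hL : 1 ≤ L) {K : ℕ} {Ω : ℕ → Set (Fin (d + 1) → ℤ)} (c : CubeB8D (d + 1) L K Ω) {n : ℕ} (hn : n ≤ c.k)
    {η : ℝ} (hη : η ≠ 0) (w : ℕ → ℝ) (hw0 : ∀ j, 0 ≤ w j) {amax : ℝ} (hamax0 : 0 ≤ amax)
    (hamax : ∀ j, j ≤ n → w j * η ^ 2 * ((L : ℝ) ^ j) ^ 2 * ((((L : ℝ) ^ (d + 1)) ^ j))⁻¹ ≤ amax)
    (S : Finset (Fin (d + 1) → ℤ)) (hS : ∀ x, x ∈ S ↔ x ∈ c.sq 0)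
    (B : Finset (ℕ × (Fin (d + 1) → ℤ))) (hB : ∀ p, p ∈ B ↔ p.1 ≤ n ∧ p.2 ∈ c.lamST n p.1)
    (K : (Fin (d + 1) → ℤ) → (Fin (d + 1) → ℤ) → ℝ)
    (hK : ∀ x z, K x z = ((η ^ 2)⁻¹ * ∑ μ : Fin (d + 1), ((2 : ℝ) * (if z = x then (1 : ℝ) else 0) - (if z = x + e μ then (1 : ℝ) else 0)
        - (if z = x - e μ then (1 : ℝ) else 0))) +
        (∑ j ∈ Finset.range (n + 1), (if blockMap (L ^ j) x ∈ c.lamST n j ∧ blockMap (L ^ j) z = blockMap (L ^ j) x then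
          w j * ((((L : ℝ) ^ (d + 1))⁻¹) ^ j) ^ 2 else 0)))
    (T : Matrix ↥S ↥S ℝ) (hT : T = Matrix.of (fun x z : ↥S => K x.1 z.1))
    (Q : Matrix ↥B ↥S ℝ) (hQ : Q = Matrix.of (fun (p : ↥B) (z : ↥S) =>
      if blockMap (L ^ p.1.1) z.1 = p.1.2 then (((L : ℝ) ^ (d + 1))⁻¹) ^ p.1.1 else 0))
    {BG B₀'H B₂' : ℝ} (hBG : 0 ≤ BG)
    (hR1 : ∀ (ρ' : ↥S → ℝ) (r : ℝ), 0 ≤ r →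
      (∀ j, j ≤ n → ∀ z : ↥S, z.1 ∈ c.sq j → wt L η j ^ 2 * |ρ' z| ≤ r) →
      ∀ φ : (Fin (d + 1) → ℤ) → ℝ, (∀ x, x ∉ c.sq 0 → φ x = 0) → (∀ v : ↥S, φ v.1 = ∑ z : ↥S, T⁻¹ v z * ρ' z) →
      ∀ x, |φ x| ≤ BG * r)
    (hR2 : ∀ (X : ↥B → ℝ) (s : ℝ), 0 ≤ s → (∀ p', |X p'| ≤ s) →
      ∀ φ : (Fin (d + 1) → ℤ) → ℝ, (∀ x, x ∉ c.sq 0 → φ x = 0) →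
      (∀ v : ↥S, φ v.1 = ∑ p' : ↥B, (T⁻¹ * (T⁻¹ * Qᵀ) * (Q * T⁻¹ * T⁻¹ * Qᵀ)⁻¹) v p' * X p') →
      (∀ x, |φ x| ≤ B₀'H * s) ∧
      (∀ j, j ≤ n → ∀ x ∈ c.sq j,
        wt L η j ^ 2 * |∑ μ : Fin (d + 1), (η ^ 2)⁻¹ * (2 * φ x - φ (x + e μ) - φ (x - e μ))| ≤ B₂' * s))
    (ρ' : ↥S → ℝ) (r : ℝ) (hr : 0 ≤ r)
    (hρ' : ∀ j, j ≤ n → ∀ z : ↥S, z.1 ∈ c.sq j → wt L η j ^ 2 * |ρ' z| ≤ r)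
    (j : ℕ) (hj : j ≤ n) (v : ↥S) (hv : v.1 ∈ c.sq j) :
    wt L η j ^ 2 * |ρ' v - ∑ z : ↥S, (T⁻¹ * (Qᵀ * ((Q * T⁻¹ * T⁻¹ * Qᵀ)⁻¹ * (Q * T⁻¹)))) v z * ρ' z| ≤ (1 + (B₂' + amax) * BG) * r := by
  have hd : 0 < d + 1 := Nat.succ_pos d
  have hL0 : (0 : ℝ) < L := by exact_mod_cast hL
  have hL1 : (1 : ℝ) ≤ L := by exact_mod_cast hL
  -- the units `T` and `QT⁻²Qᵀ`
  have hTunit : IsUnit T := by rw [hT]; exact isUnit_flatMatrix hd hη L n (c.lamST n) w hw0 K hK S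
  have hTT : T * T⁻¹ = 1 := Matrix.mul_nonsing_inv T ((Matrix.isUnit_iff_isUnit_det T).mp hTunit)
  have hmeet : ∀ p ∈ B, ∃ z ∈ S, blockMap (L ^ p.1) z = p.2 := by
    intro p hp
    obtain ⟨hp1, hp2⟩ := (hB p).mp hp
    obtain ⟨z, hz, hzb⟩ := tower_meets_dented c hL hn p.1 hp1 p.2 hp2
    exact ⟨z, (hS z).mpr hz, hzb⟩
  have hdisjB : ∀ p ∈ B, ∀ p' ∈ B, ∀ z ∈ S, blockMap (L ^ p.1) z = p.2 → blockMap (L ^ p'.1) z = p'.2 → p = p' := by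
    intro p hp p' hp' z hz h1 h2
    obtain ⟨hp1, hp2⟩ := (hB p).mp hp
    obtain ⟨hp1', hp2'⟩ := (hB p').mp hp'
    obtain ⟨hjj, hyy⟩ := towers_disjoint_dented c hL hn p.1 hp1 p'.1 hp1' p.2 hp2 p'.2 hp2' z ((hS z).mp hz) h1 h2
    exact Prod.ext hjj hyy
  have hMunit : IsUnit (Q * T⁻¹ * T⁻¹ * Qᵀ) := by
    rw [hQ, hT]; exact isUnit_towerGram hd hη hL n (c.lamST n) w hw0 K hK S B hmeet hdisjB
  have hMM : (Q * T⁻¹ * T⁻¹ * Qᵀ) * (Q * T⁻¹ * T⁻¹ * Qᵀ)⁻¹ = 1 :=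
    Matrix.mul_nonsing_inv _ ((Matrix.isUnit_iff_isUnit_det _).mp hMunit)
  -- the letters `φ₁ = T⁻¹ρ′`, `X = Q·T⁻¹ρ′`, `λ = H′X`
  set φ₁ : (Fin (d + 1) → ℤ) → ℝ := fun x => if h : x ∈ S then ∑ z : ↥S, T⁻¹ ⟨x, h⟩ z * ρ' z else 0 with hφ₁
  have hφ₁0 : ∀ x, x ∉ c.sq 0 → φ₁ x = 0 := fun x hx => by rw [hφ₁]; exact dif_neg (fun h => hx ((hS x).mp h))
  have hφ₁S : ∀ u : ↥S, φ₁ u.1 = ∑ z : ↥S, T⁻¹ u z * ρ' z := fun u => by rw [hφ₁]; exact dif_pos u.2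
  have hφ₁b : ∀ x, |φ₁ x| ≤ BG * r := hR1 ρ' r hr hρ' φ₁ hφ₁0 hφ₁S
  have hφ₁v : ∀ u : ↥S, φ₁ u.1 = (T⁻¹ *ᵥ ρ') u := fun u => by rw [hφ₁S]; rfl
  set X : ↥B → ℝ := Q *ᵥ (T⁻¹ *ᵥ ρ') with hX
  -- `|X| ≤ B_G r`: block averages of `φ₁`
  have hXb : ∀ p : ↥B, |X p| ≤ BG * r := by
    intro p
    obtain ⟨hp1, hp2⟩ := (hB p.1).mp p.2
    obtain ⟨z₀, hz₀S, hz₀⟩ := hmeet p.1 p.2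
    have hXp : X p = (((L : ℝ) ^ (d + 1))⁻¹) ^ p.1.1 * ∑ z ∈ S.filter (fun z => blockMap (L ^ p.1.1) z = blockMap (L ^ p.1.1) z₀), φ₁ z := by
      rw [hX, Matrix.mulVec, dotProduct, Finset.sum_filter, Finset.mul_sum, ← Finset.sum_coe_sort S]
      refine Finset.sum_congr rfl fun z _ => ?_
      rw [hQ, Matrix.of_apply, hφ₁v z, hz₀]
      split_ifs <;> ring
    have hfull : ∀ z, blockMap (L ^ p.1.1) z = blockMap (L ^ p.1.1) z₀ → z ∈ S := by
      intro z hz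
      exact (hS z).mpr (towerBlock_subset_sq c hL hn hp1 (by rw [hz₀]; exact hp2) hz)
    have hcard := card_filter_block_le hL p.1.1 S z₀ hfull
    have hsum : |∑ z ∈ S.filter (fun z => blockMap (L ^ p.1.1) z = blockMap (L ^ p.1.1) z₀), φ₁ z| ≤ ((L : ℝ) ^ (d + 1)) ^ p.1.1 * (BG * r) := by
      refine (Finset.abs_sum_le_sum_abs _ _).trans ?_
      refine (Finset.sum_le_sum fun z _ => hφ₁b z).trans ?_
      rw [Finset.sum_const, nsmul_eq_mul]
      exact mul_le_mul_of_nonneg_right hcard (by positivity)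
    rw [hXp, abs_mul, abs_of_nonneg (by positivity)]
    have hpow : 0 < ((L : ℝ) ^ (d + 1)) ^ p.1.1 := by positivity
    calc (((L : ℝ) ^ (d + 1))⁻¹) ^ p.1.1 * |∑ z ∈ S.filter (fun z => blockMap (L ^ p.1.1) z = blockMap (L ^ p.1.1) z₀), φ₁ z|
        ≤ (((L : ℝ) ^ (d + 1))⁻¹) ^ p.1.1 * (((L : ℝ) ^ (d + 1)) ^ p.1.1 * (BG * r)) := mul_le_mul_of_nonneg_left hsum (by positivity)
      _ = BG * r := by rw [inv_pow]; field_simp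
  -- `λ = H′X` and its zero extension; the REAL-2 bounds at `s = B_G r`
  set lam : ↥S → ℝ := (T⁻¹ * (T⁻¹ * Qᵀ) * (Q * T⁻¹ * T⁻¹ * Qᵀ)⁻¹) *ᵥ X with hlam
  obtain ⟨lamf, hlamfS0, hlamfS'⟩ : ∃ f : (Fin (d + 1) → ℤ) → ℝ, (∀ u : ↥S, f u.1 = lam u) ∧ (∀ x, x ∉ S → f x = 0) :=
    ⟨fun x => if h : x ∈ S then lam ⟨x, h⟩ else 0, fun u => by simp [u.2], fun x hx => by simp [hx]⟩
  have hlamf0 : ∀ x, x ∉ c.sq 0 → lamf x = 0 := fun x hx => hlamfS' x (fun h => hx ((hS x).mp h))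
  have hlamfS : ∀ u : ↥S, lamf u.1 = ∑ p' : ↥B, (T⁻¹ * (T⁻¹ * Qᵀ) * (Q * T⁻¹ * T⁻¹ * Qᵀ)⁻¹) u p' * X p' := by
    intro u; rw [hlamfS0]; rfl
  obtain ⟨-, hΔ⟩ := hR2 X (BG * r) (by positivity) hXb lamf hlamf0 hlamfS
  -- the operator of REAL-3 applied to `ρ′` is `T·λ`
  have hop : ∀ u : ↥S, ∑ z : ↥S, (T⁻¹ * (Qᵀ * ((Q * T⁻¹ * T⁻¹ * Qᵀ)⁻¹ * (Q * T⁻¹)))) u z * ρ' z = (T *ᵥ lam) u := by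
    intro u
    have hmat : T * (T⁻¹ * (T⁻¹ * Qᵀ) * (Q * T⁻¹ * T⁻¹ * Qᵀ)⁻¹) * Q * T⁻¹ = T⁻¹ * (Qᵀ * ((Q * T⁻¹ * T⁻¹ * Qᵀ)⁻¹ * (Q * T⁻¹))) := by
      simp only [← Matrix.mul_assoc]
      rw [hTT, Matrix.one_mul]
    rw [hlam, hX, Matrix.mulVec_mulVec, Matrix.mulVec_mulVec, Matrix.mulVec_mulVec, hmat]
    rfl
  -- `Qλ = X` (`QH′ = 1`)
  have hQlam : Q *ᵥ lam = X := by
    rw [hlam, Matrix.mulVec_mulVec]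
    have : Q * (T⁻¹ * (T⁻¹ * Qᵀ) * (Q * T⁻¹ * T⁻¹ * Qᵀ)⁻¹) = 1 := by
      rw [show Q * (T⁻¹ * (T⁻¹ * Qᵀ) * (Q * T⁻¹ * T⁻¹ * Qᵀ)⁻¹) = (Q * T⁻¹ * T⁻¹ * Qᵀ) * (Q * T⁻¹ * T⁻¹ * Qᵀ)⁻¹ by
        simp only [← Matrix.mul_assoc], hMM]
    rw [this, Matrix.one_mulVec]
  -- the row of `T` at `v` against `λ`
  have hrow : (T *ᵥ lam) v = ∑ z ∈ S, K v.1 z * lamf z := by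
    rw [Matrix.mulVec, dotProduct, ← Finset.sum_coe_sort S]
    refine Finset.sum_congr rfl fun z _ => ?_
    rw [hT, Matrix.of_apply, hlamfS0 z]
  have hKrow := K_row_sum_zeroExt L n (c.lamST n) w K hK S v.2 lamf hlamfS'
  -- the tower level `J` of `v`, and `j ≤ J`
  have hv0 : v.1 ∈ c.sq 0 := (hS v.1).mp v.2
  obtain ⟨J, hJn, hvJ⟩ := cover_dented c hL hn v.1 hv0
  have hjJ : j ≤ J := le_towerLevel_dented c hL hn hJn hvJ hj hv
  -- collapse of the level sum to `J`
  have hcollapse : ∑ j' ∈ Finset.range (n + 1), (if blockMap (L ^ j') v.1 ∈ c.lamST n j' then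
        w j' * ((((L : ℝ) ^ (d + 1))⁻¹) ^ j') ^ 2 * ∑ z ∈ S.filter (fun z => blockMap (L ^ j') z = blockMap (L ^ j') v.1), lamf z else 0)
      = w J * ((((L : ℝ) ^ (d + 1))⁻¹) ^ J) ^ 2 * ∑ z ∈ S.filter (fun z => blockMap (L ^ J) z = blockMap (L ^ J) v.1), lamf z := by
    have h : ∀ j' ∈ Finset.range (n + 1), (if blockMap (L ^ j') v.1 ∈ c.lamST n j' then
        w j' * ((((L : ℝ) ^ (d + 1))⁻¹) ^ j') ^ 2 * ∑ z ∈ S.filter (fun z => blockMap (L ^ j') z = blockMap (L ^ j') v.1), lamf z else 0)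
        = if J = j' then w J * ((((L : ℝ) ^ (d + 1))⁻¹) ^ J) ^ 2 * ∑ z ∈ S.filter (fun z => blockMap (L ^ J) z = blockMap (L ^ J) v.1), lamf z else 0 := by
      intro j' hj'
      have hj'n : j' ≤ n := Nat.lt_succ_iff.mp (Finset.mem_range.mp hj')
      by_cases hc : blockMap (L ^ j') v.1 ∈ c.lamST n j'
      · have hjj : j' = J := (towers_disjoint_dented c hL hn j' hj'n J hJn _ hc _ hvJ v.1 hv0 rfl rfl).1
        subst hjj; rw [if_pos hc, if_pos rfl]
      · have hne : J ≠ j' := fun h => by subst h; exact hc hvJ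
        rw [if_neg hc, if_neg hne]
    rw [Finset.sum_congr rfl h, Finset.sum_ite_eq, if_pos (Finset.mem_range.mpr (Nat.lt_succ_of_le hJn))]
  -- the block sum is `L^{(d+1)J}·X_{p(v)}`
  have hpB : (J, blockMap (L ^ J) v.1) ∈ B := (hB _).mpr ⟨hJn, hvJ⟩
  have hblock : ∑ z ∈ S.filter (fun z => blockMap (L ^ J) z = blockMap (L ^ J) v.1), lamf z
      = ((L : ℝ) ^ (d + 1)) ^ J * X ⟨(J, blockMap (L ^ J) v.1), hpB⟩ := by
    have hQl : (Q *ᵥ lam) ⟨(J, blockMap (L ^ J) v.1), hpB⟩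
        = (((L : ℝ) ^ (d + 1))⁻¹) ^ J * ∑ z ∈ S.filter (fun z => blockMap (L ^ J) z = blockMap (L ^ J) v.1), lamf z := by
      rw [Matrix.mulVec, dotProduct, Finset.sum_filter, Finset.mul_sum, ← Finset.sum_coe_sort S]
      refine Finset.sum_congr rfl fun z _ => ?_
      rw [hQ, Matrix.of_apply, hlamfS0 z]
      dsimp only
      split_ifs <;> ring
    rw [hQlam] at hQl
    rw [hQl, inv_pow, ← mul_assoc, mul_inv_cancel₀ (by positivity), one_mul]
  -- the weight factor: `(Lʲη)²·w_J·L^{−(d+1)J} ≤ a_max` since `j ≤ J`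
  have hwt : wt L η j ^ 2 * (w J * ((((L : ℝ) ^ (d + 1))⁻¹) ^ J) ^ 2 * ((L : ℝ) ^ (d + 1)) ^ J) ≤ amax := by
    have hJ := hamax J hJn
    have hid : wt L η j ^ 2 * (w J * ((((L : ℝ) ^ (d + 1))⁻¹) ^ J) ^ 2 * ((L : ℝ) ^ (d + 1)) ^ J)
        = (w J * η ^ 2 * ((L : ℝ) ^ J) ^ 2 * ((((L : ℝ) ^ (d + 1)) ^ J))⁻¹) * (((L : ℝ) ^ j) ^ 2 / ((L : ℝ) ^ J) ^ 2) := by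
      unfold wt; rw [inv_pow]; field_simp
    rw [hid]
    have hratio : ((L : ℝ) ^ j) ^ 2 / ((L : ℝ) ^ J) ^ 2 ≤ 1 := by
      rw [div_le_one (by positivity)]
      exact pow_le_pow_left₀ (by positivity) (pow_le_pow_right₀ hL1 hjJ) 2
    have hnn : 0 ≤ w J * η ^ 2 * ((L : ℝ) ^ J) ^ 2 * ((((L : ℝ) ^ (d + 1)) ^ J))⁻¹ := by
      have := hw0 J; positivity
    calc (w J * η ^ 2 * ((L : ℝ) ^ J) ^ 2 * ((((L : ℝ) ^ (d + 1)) ^ J))⁻¹) * (((L : ℝ) ^ j) ^ 2 / ((L : ℝ) ^ J) ^ 2)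
        ≤ amax * 1 := mul_le_mul hJ hratio (by positivity) hamax0
      _ = amax := mul_one _
  -- assemble
  have hΔv := hΔ j hj v.1 hv
  have hLap : wt L η j ^ 2 * |(η ^ 2)⁻¹ * ∑ μ : Fin (d + 1), (2 * lamf v.1 - lamf (v.1 + e μ) - lamf (v.1 - e μ))| ≤ B₂' * (BG * r) := by
    rw [Finset.mul_sum]; exact hΔv
  have hρv : wt L η j ^ 2 * |ρ' v| ≤ r := hρ' j hj v hv
  have hwt0 : 0 ≤ wt L η j ^ 2 := sq_nonneg _
  rw [hop v, hrow, hKrow, hcollapse, hblock]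
  have hblk : wt L η j ^ 2 * |w J * ((((L : ℝ) ^ (d + 1))⁻¹) ^ J) ^ 2 * (((L : ℝ) ^ (d + 1)) ^ J * X ⟨(J, blockMap (L ^ J) v.1), hpB⟩)|
      ≤ amax * (BG * r) := by
    rw [show w J * ((((L : ℝ) ^ (d + 1))⁻¹) ^ J) ^ 2 * (((L : ℝ) ^ (d + 1)) ^ J * X ⟨(J, blockMap (L ^ J) v.1), hpB⟩)
        = (w J * ((((L : ℝ) ^ (d + 1))⁻¹) ^ J) ^ 2 * ((L : ℝ) ^ (d + 1)) ^ J) * X ⟨(J, blockMap (L ^ J) v.1), hpB⟩ by ring,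
      abs_mul, abs_of_nonneg (by have := hw0 J; positivity), ← mul_assoc]
    exact mul_le_mul hwt (hXb _) (abs_nonneg _) hamax0
  calc wt L η j ^ 2 * |ρ' v - ((η ^ 2)⁻¹ * ∑ μ : Fin (d + 1), (2 * lamf v.1 - lamf (v.1 + e μ) - lamf (v.1 - e μ))
        + w J * ((((L : ℝ) ^ (d + 1))⁻¹) ^ J) ^ 2 * (((L : ℝ) ^ (d + 1)) ^ J * X ⟨(J, blockMap (L ^ J) v.1), hpB⟩))|
      ≤ wt L η j ^ 2 * (|ρ' v| + (|(η ^ 2)⁻¹ * ∑ μ : Fin (d + 1), (2 * lamf v.1 - lamf (v.1 + e μ) - lamf (v.1 - e μ))|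
        + |w J * ((((L : ℝ) ^ (d + 1))⁻¹) ^ J) ^ 2 * (((L : ℝ) ^ (d + 1)) ^ J * X ⟨(J, blockMap (L ^ J) v.1), hpB⟩)|)) := by
        refine mul_le_mul_of_nonneg_left ?_ hwt0
        exact (abs_sub _ _).trans (add_le_add le_rfl (abs_add_le _ _))
    _ ≤ r + (B₂' * (BG * r) + amax * (BG * r)) := by
        rw [mul_add, mul_add]; exact add_le_add hρv (add_le_add hLap hblk)
    _ = (1 + (B₂' + amax) * BG) * r := by ring


#print axioms real3_of_real1_real2_dented

end Literature.MathematicalPhysics.QuantumFieldTheory.Balaban1983to89.B8Eq198DentedCubeMemberOfReal12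

end
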